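import Summits.CriticalPhenomena.PercolationContinuityZ3.Theorems.PercNearOneGluingNoHeavyLowerTailSahiSymCubeMemo
import Summits.CriticalPhenomena.PercolationContinuityZ3.Theorems.PercNearOneGluingNoHeavyLowerTailSahiSymCubeCheck

/-!
# Sahi's `E_n` on the cube `{0,1}^m` by INTERPOLATION ON THE GRID `{0, 1/n, …, 1}^m`: the checker (a leaf test for the symmetry-reduced
# coloured-antichain check …`SahiSymCubeCheck.symCheckT`)

Support file (cell `prim-sahi`, seat `prim-sahi-typer` gen 30; `--supports stmt-CriticalPhenomena-4575`).  COMPUTABLE DEFINITIONS ONLY (nothing is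
evaluated, nothing about the crux is asserted); soundness in …`SahiInterpDP`, …`SahiInterpTransform`, …`SahiInterpSound`; the order-10 evaluation on
`{0,1}^5` in a computational file.  Purpose: the tree's digit test (`NCopyCert.checkFamW`, the Lieb–Sahi recursion run on Kronecker numbers of the
degree-`n` tensor-Bernstein coefficient vector `sahiCoef`, `(n+1)^m` digits per number) is out of reach at `(m, n) = (5, 10)`; here the SAME coefficient
vector `γ = sahiCoef m n a` (so `E_n(μ_p; a) = evB n γ p`, `NCopyCert.evB_sahiCoef`) is recovered from the VALUES of `E_n` at the `(n+1)^m` grid points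
`p = x/n` — `c^m · γ_K = Σ_x Π_i H_{K_i, x_i} · Z(x)`, `Z(x) = n^{m n} · E_n(μ_{x/n}) ∈ ℤ`, for any integer matrix `H` with `H · B = c · 1`,
`B_{y,k} = y^k (n − y)^{n−k}` — and each value is ONE run of the block-peeling recursion over the `2^n` sub-families (…`SahiInterpSubsetRec.csW_rec`)
in exact integer arithmetic; for a family invariant under the coordinate permutations (up to relabelling) only SORTED grid points are evaluated.

* grid moments: `atomW`, `atomTab`, `ptsBelow`/`momL`, static block data `maskTab` (…`SahiSymCubeMemo.andMaskF`)/`ptsTab`, `momTab` (moment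
  numerators `n^m · μ_{x/n}(⋂_{i∈S} A_i)` of all blocks `S < 2^n`);
* the DP: `bitsD`, `subSum` (sum over the sub-masks of a list of bit positions), `coefTab` (`k!·D^k`), `pcTab`, `zEntry`, `zArr`, `zTop`, **`zVal m n d a x`**
  (`= d^{m n} · E_n(μ_{x/d}; a)`, proved in …`SahiInterpDP`);
* grid points `Fin m → Fin (d+1)` with keys `enc` (Mathlib's `finFunctionFinEquiv`): `cswapA`/`bubbleA`/`sortA`/`sortKey` (bubble sort of the
  coordinate array by adjacent swaps),
  **`gridArr`** (the key-indexed table of values at sorted points, thunk-memoised), `axisSum`/**`transformA`** (`m` axis passes with `H` on key-indexed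
  tables), `bMat`/`checkH` (`H·B = c·1`);
* symmetry: `pullN` (bitmask of the pull-back of an event along a coordinate permutation), `reidx`/`reindexOK`/`symFam` (the permuted family is a
  relabelling of the family, for every permutation in `SahiSymCube.permsL m`);
* **`testI m n H c a`** — the leaf test: `0 < n`, `0 < c`, `checkH`, `symFam`, and all `(n+1)^m` transformed values `≥ 0`. [this work]
-/

namespace Summit.CriticalPhenomena.PercolationContinuityZ3.Theorems.SahiInterp

open Finset OneCutCert SahiC3Cube NCopyCert SahiSymCube

/-! ## Grid moments -/

/-- Weight numerator of the cube point `y` at the grid point `x` (denominator `d`): `Π_{i<m} (x_i if bit i of y, else d − x_i)` (explicit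
recursion on the coordinates). [this work] -/
def atomW (d : ℕ) (x : ℕ → ℕ) (y : ℕ) : ℕ → ℤ
  | 0 => 1
  | i + 1 => atomW d x y i * (if y.testBit i then (x i : ℤ) else (d : ℤ) - (x i : ℤ))

/-- The table of the `2^m` weight numerators at a grid point. [this work] -/
def atomTab (m d : ℕ) (x : Fin m → ℕ) : Array ℤ :=
  let xs : Array ℕ := Array.ofFn x
  Array.ofFn fun y : Fin (2 ^ m) => atomW d (fun i => xs.getD i 0) y m

/-- The points `y < k` of an event bitmask `M`, as a list (increasing). [this work] -/
def ptsBelow (M : ℕ) : ℕ → List ℕ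
  | 0 => []
  | y + 1 => if M.testBit y then ptsBelow M y ++ [y] else ptsBelow M y

/-- Moment numerator of a list of points: `Σ_{y ∈ l} w_y`. [this work] -/
def momL (w : Array ℤ) (l : List ℕ) : ℤ := l.foldl (fun acc y => acc + w.getD y 0) 0

/-- STATIC family data: the bitmasks `⋀_{i∈S} a_i` of all blocks `S < 2^n` (…`SahiSymCubeMemo.andMaskF`; the full cube for `S = 0`) and their
point lists. [this work] -/
def maskTab (m n : ℕ) (aL : List ℕ) : Array ℕ := Array.ofFn fun S : Fin (2 ^ n) => andMaskF (fullN m) aL S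

/-- The point lists of all blocks. [this work] -/
def ptsTab (m n : ℕ) (maskT : Array ℕ) : Array (List ℕ) := Array.ofFn fun S : Fin (2 ^ n) => ptsBelow (maskT.getD S 0) (2 ^ m)

/-- Moment numerators of all blocks at a grid point (`= d^m · μ_{x/d}(⋂_{i∈S} A_i)`). [this work] -/
def momTab (n : ℕ) (ptsT : Array (List ℕ)) (w : Array ℤ) : Array ℤ := Array.ofFn fun S : Fin (2 ^ n) => momL w (ptsT.getD S [])

/-! ## The block-peeling dynamic programme -/

/-- The set bits of `M` below `n`, DEcreasing (highest first). [this work] -/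
def bitsD (n M : ℕ) : List (Fin n) := ((List.finRange n).filter fun j : Fin n => M.testBit (j : ℕ)).reverse

/-- `Σ_{S} g (acc ||| S)` over the sub-masks `S` with bits from the given list of positions. [this work] -/
def subSum {n : ℕ} (g : ℕ → ℤ) : List (Fin n) → ℕ → ℤ
  | [], acc => g acc
  | j :: l, acc => subSum g l acc + subSum g l (acc ||| 2 ^ (j : ℕ))

/-- The coefficients `k! · D^k`, `k ≤ n`. [this work] -/
def coefTab (n : ℕ) (D : ℤ) : Array ℤ := Array.ofFn fun k : Fin (n + 1) => ((k : ℕ).factorial : ℤ) * D ^ (k : ℕ)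

/-- The number of set bits below `n` of every `S < 2^n`. [this work] -/
def pcTab (n : ℕ) : Array ℕ := Array.ofFn fun S : Fin (2 ^ n) => (bitsD n S).length

/-- One entry of the DP: for `W ≠ 0` with HIGHEST set bit `v` and `W' = W ∖ {v}`,
`Z(W) = (|W|−1)!·D^{|W|−1}·mom(W) − Σ_{S ⊊ W'} |S|!·D^{|S|}·mom(S ∪ {v})·Z(W' ∖ S)` (entries `Z(·)` of smaller index read from `z`). [this work] -/
def zEntry (n : ℕ) (coef : Array ℤ) (pcT : Array ℕ) (mom : Array ℤ) (z : Array ℤ) (W : ℕ) : ℤ :=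
  match bitsD n W with
  | [] => 0
  | v :: rest =>
    coef.getD rest.length 0 * mom.getD W 0 -
      subSum (fun S => if S = W ^^^ 2 ^ (v : ℕ) then 0 else
        coef.getD (pcT.getD S 0) 0 * mom.getD (S ||| 2 ^ (v : ℕ)) 0 * z.getD ((W ^^^ 2 ^ (v : ℕ)) ^^^ S) 0) rest 0

/-- The DP array of the entries `Z(W)`, `W < k`. [this work] -/
def zArr (n : ℕ) (coef : Array ℤ) (pcT : Array ℕ) (mom : Array ℤ) : ℕ → Array ℤ
  | 0 => #[]
  | k + 1 =>
    let z := zArr n coef pcT mom k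
    z.push (zEntry n coef pcT mom z k)

/-- The top entry `Z(2^n − 1)` from the entries below `2^(n−1)` (only sub-families avoiding the top index are ever needed). [this work] -/
def zTop (n : ℕ) (coef : Array ℤ) (pcT : Array ℕ) (mom : Array ℤ) : ℤ :=
  zEntry n coef pcT mom (zArr n coef pcT mom (2 ^ (n - 1))) (2 ^ n - 1)

/-- **`zVal m n d a x = d^{m n} · E_n(μ_{x/d}; A)`** for the family of event bitmasks `a` at the grid point `x` (…`SahiInterpDP.zVal_eq`).
[this work] -/
def zVal (m n d : ℕ) (a : Fin n → ℕ) (x : Fin m → ℕ) : ℤ :=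
  zTop n (coefTab n ((d : ℤ) ^ m)) (pcTab n) (momTab n (ptsTab m n (maskTab m n (List.ofFn a))) (atomTab m d x))

/-! ## Grid points, sorting, the grid table -/

/-- Compare–swap of the entries `i, i+1` of an array (a no-op if `i + 1 ≥ size`). [this work] -/
def cswapA (i : ℕ) (xs : Array ℕ) : Array ℕ :=
  if h : i + 1 < xs.size then
    if xs[i + 1] < xs[i]'(Nat.lt_of_succ_lt h) then xs.swap i (i + 1) (Nat.lt_of_succ_lt h) h else xs
  else xs

/-- One bubble pass: compare–swaps at positions `0, …, m − 2`. [this work] -/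
def bubbleA (m : ℕ) (xs : Array ℕ) : Array ℕ := (List.range (m - 1)).foldl (fun z i => cswapA i z) xs

/-- Bubble sort (`k` passes); only "the result is a rearrangement `x ∘ σ`" is ever used. [this work] -/
def sortA (m : ℕ) : ℕ → Array ℕ → Array ℕ
  | 0, xs => xs
  | k + 1, xs => sortA m k (bubbleA m xs)

/-- The key of a grid point: `Σ_i x_i (d+1)^i` (Mathlib's `finFunctionFinEquiv`). [this work] -/
def enc {m d : ℕ} (x : Fin m → Fin (d + 1)) : ℕ := (finFunctionFinEquiv x : ℕ)

/-- The key of the SORTED rearrangement of a grid point. [this work] -/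
def sortKey (m d : ℕ) (x : Fin m → Fin (d + 1)) : ℕ :=
  let ys := sortA m m (Array.ofFn fun j : Fin m => (x j : ℕ))
  enc fun j : Fin m => (⟨ys.getD j 0 % (d + 1), Nat.mod_lt _ (Nat.succ_pos d)⟩ : Fin (d + 1))

/-- **The grid table**: entry `i < (n+1)^m` is `zVal m n n a` at the SORTED rearrangement of the grid point with key `i` — the DP runs once per
sorted point (thunks), the static family data is shared. [this work] -/
def gridArr (m n : ℕ) (a : Fin n → ℕ) : Array ℤ :=
  let coef := coefTab n ((n : ℤ) ^ m)
  let pcT := pcTab n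
  let ptsT := ptsTab m n (maskTab m n (List.ofFn a))
  let zT : Array (Thunk ℤ) := Array.ofFn fun i : Fin ((n + 1) ^ m) =>
    Thunk.mk fun _ => zTop n coef pcT (momTab n ptsT (atomTab m n fun j => ((finFunctionFinEquiv.symm i) j : ℕ)))
  Array.ofFn fun i : Fin ((n + 1) ^ m) => (zT.getD (sortKey m n (finFunctionFinEquiv.symm i)) (Thunk.pure 0)).get

/-! ## The tensor transform -/

/-- Sum over the last coordinate: `Σ_{y ≤ d} H k y · (sub[y])[r]`. [this work] -/
def axisSum (d : ℕ) (H : Fin (d + 1) → Fin (d + 1) → ℤ) (sub : Array (Array ℤ)) (k : Fin (d + 1)) (r : ℕ) : ℤ :=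
  ∑ y : Fin (d + 1), H k y * (sub.getD y #[]).getD r 0

/-- **The transform** on key-indexed tables: `(T Z)[key K] = Σ_x (Π_i H_{K_i, x_i}) · Z[key x]`, by `m` successive contractions of the LAST
coordinate (the slices of a fixed last coordinate are contiguous key ranges) (…`SahiInterpTransform.transformA_eq`). [this work] -/
def transformA (d : ℕ) (H : Fin (d + 1) → Fin (d + 1) → ℤ) : (m : ℕ) → Array ℤ → Array ℤ
  | 0, Z => #[Z.getD 0 0]
  | m + 1, Z =>
    let sub : Array (Array ℤ) := Array.ofFn fun y : Fin (d + 1) =>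
      transformA d H m (Z.extract ((y : ℕ) * (d + 1) ^ m) (((y : ℕ) + 1) * (d + 1) ^ m))
    Array.ofFn fun idx : Fin ((d + 1) ^ (m + 1)) =>
      axisSum d H sub ⟨(idx : ℕ) / (d + 1) ^ m, Nat.div_lt_of_lt_mul (lt_of_lt_of_eq idx.isLt (pow_succ _ _))⟩
        ((idx : ℕ) % (d + 1) ^ m)

/-- The scaled Bernstein values on the grid: `B_{y,k} = y^k (d − y)^{d − k}` (`= d^d · bernW d (y/d) k`). [this work] -/
def bMat (d : ℕ) (y k : Fin (d + 1)) : ℤ := (y : ℤ) ^ (k : ℕ) * ((d : ℤ) - y) ^ (d - k)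

/-- `H · B = c · 1`. [this work] -/
def checkH (d : ℕ) (H : Fin (d + 1) → Fin (d + 1) → ℤ) (c : ℤ) : Bool :=
  decide (∀ k k' : Fin (d + 1), (∑ y : Fin (d + 1), H k y * bMat d y k') = if k = k' then c else 0)

/-! ## Symmetry of a family under the coordinate permutations -/

/-- Bitmask of the PULL-BACK `{S | σ '' S ∈ A}` of the event with bitmask `M` along the coordinate map `σ` (list form): bit `y` = bit `σ·y` of `M`.
[this work] -/
def pullN (m : ℕ) (σL : List ℕ) (M : ℕ) : ℕ := ofBits (fun y => M.testBit (actL m σL y)) (2 ^ m)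

/-- A relabelling candidate: the first index `j` with `a j = b i` (or `i` if none). [this work] -/
def reidx (n : ℕ) (a b : Fin n → ℕ) (i : Fin n) : Fin n :=
  match (List.finRange n).find? (fun j => a j == b i) with
  | some j => j
  | none => i

/-- `b` is a relabelling of `a` by a permutation (checked: `reidx` hits and is injective). [this work] -/
def reindexOK (n : ℕ) (a b : Fin n → ℕ) : Bool :=
  decide (∀ i, a (reidx n a b i) = b i) && decide (Function.Injective (reidx n a b))

/-- **The family is invariant, up to relabelling, under every coordinate permutation.** [this work] -/
def symFam (m n : ℕ) (a : Fin n → ℕ) : Bool :=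
  (permsL m).all fun σL => reindexOK n a (fun i => pullN m σL (a i))

/-! ## The leaf test -/

/-- **THE INTERPOLATION LEAF TEST** of a family of `n` event bitmasks of the `m`-cube with certificate matrix `H` and constant `c`: `0 < n`, `0 < c`,
`H · B = c · 1`, the family is symmetric, and every entry of the transform of the grid values is `≥ 0` — then (…`SahiInterpSound.testI_sound`)
`E_n(μ_p; A) ≥ 0` for EVERY product weight. [this work] -/
def testI (m n : ℕ) (H : Fin (n + 1) → Fin (n + 1) → ℤ) (c : ℤ) (a : Fin n → ℕ) : Bool :=
  decide (0 < n) && decide (0 < c) && checkH n H c && symFam m n a &&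
    (transformA n H m (gridArr m n a)).all fun v => decide (0 ≤ v)

end Summit.CriticalPhenomena.PercolationContinuityZ3.Theorems.SahiInterp
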